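import Summits.SmoothPoincare4.SmoothPoincare4.Theses.ZeroSurgeryExotic
import Literature.Topology.FourManifolds.KnotsProofs
import Literature.Topology.FourManifolds.SliceGenusMirrorProofs
import Literature.Topology.FourManifolds.KirbyMovesReverseProofs
import Literature.Topology.FourManifolds.ZeroSurgeryHomotopyBallSliceProofs
import Literature.Topology.FourManifolds.DehnSurgeryProofs
import Mathlib.Analysis.InnerProductSpace.Calculus
import Literature.Topology.FourManifolds.SliceRibbonIsotopyProofs
import Summits.SmoothPoincare4.SmoothPoincare4.Theorems.ZseSVanishesOnPairs.Negative.MirrorClosure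

/-!
# `ZseThesis` — negative knowledge III: reverse closure — every knot is a `0`-friend of its reverse, and the reverse partner is dead

Refuter support lemmas for crux `stmt-SmoothPoincare4-0364` (`ZeroSurgeryExotic.ZseThesis`: knots `K, K'` with a
common `0`-surgery `Y`, `K` smoothly slice, `K'` not), from the standing disprover's work file
`Summits/SmoothPoincare4/SmoothPoincare4/Cruxes/ZseThesis/Disproof.lean` §3.  All unconditional:

* `isSliceDisc_reverse`, `isSmoothlySlice_reverse_iff` — smooth sliceness does not see the string orientation
  (precompose the disc with the reflection `ρ` of `ℝ²`; `K.reverse = K ∘ ρ|_{S¹}`);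
* `isIntegralSurgery_reverse` — `m`-surgery on `K` is `m`-surgery on `K.reverse` for the SAME `Y` (the PROVED
  Kirby fact `FramedLink.IsSurgery.reverseComponent_holds` through `FramedLink.isSurgery_single_iff`); hence
  `zeroSurgeryPair_self_reverse`: `(K, Kʳ, Y)` always satisfies the pair hypotheses of the crux — in print this is
  the observation behind Livingston's counterexample to the Akbulut–Kirby conjecture (a knot not concordant to
  its reverse; Abe–Tagami 2016, §1), the simplest NON-CONCORDANT `0`-friends;
* `zseThesis_reverseWitness_false`, `zseThesis_mirrorReverseWitness_false` — yet neither `Kʳ` nor `-K̄ = K̄ʳ`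
  (the concordance inverse) can be the non-slice partner of a slice `K`; with `MirrorClosure` the whole symmetry
  group `{K, K̄, Kʳ, K̄ʳ}` of a slice knot consists of slice `0`-friends;
* `zseThesis_witness_reverse` — witnesses are closed under simultaneous reversal (same `Y`).
So the common `0`-surgery bounds neither the isotopy class, nor (in print) the concordance class, and the crux's
pair relation must be read modulo this Klein four-group. No definitions; no route item is concluded positively.
References: Kirby 1989 Ch. I §2 [Kirby1989]; Livingston 2005 §2.1 [Livingston2005]; Abe–Tagami, *Fibered knots
with the same 0-surgery and the slice-ribbon conjecture*, MRL 23 (2016) §1 [AbeTagami2016]; Gompf–Stipsicz 1999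
§5.3 [GompfStipsicz1999].
-/

noncomputable section

set_option linter.dupNamespace false

open scoped Manifold ContDiff
open Function Set
open Literature.Topology.FourManifolds
open Summit.SmoothPoincare4.SmoothPoincare4.Theses.ZeroSurgeryExotic
open Summit.SmoothPoincare4.SmoothPoincare4.Theorems.ZseSVanishesOnPairs.Negative

namespace Summit.SmoothPoincare4.SmoothPoincare4.Theorems.ZseThesis.Negative

/-! ## Sliceness is reverse-invariant -/

/-- **Reversing the string orientation preserves slice discs**: if `f` is a (neat) slice disc for `K`, then
`f ∘ ρ` is one for `K.reverse = K ∘ ρ|_{S¹}`, `ρ = reflectLastCLM 1` the reflection of `ℝ²` in the last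
coordinate (a linear isometry: it preserves the closed disc, norms, injectivity of differentials and the radial
neatness derivative). [cite: Livingston2005, §2.1] -/
theorem isSliceDisc_reverse {K : Knot} {f : EuclideanSpace ℝ (Fin 2) → EuclideanSpace ℝ (Fin 4)}
    (h : K.IsSliceDisc f) : K.reverse.IsSliceDisc (f ∘ reflectLastCLM 1) := by
  obtain ⟨hsmooth, hinj, himm, hin, hneat, hbd⟩ := h
  have hR : ∀ x : EuclideanSpace ℝ (Fin 2), ‖reflectLastCLM 1 x‖ = ‖x‖ := norm_reflectLastCLM 1
  have hRball : ∀ x : EuclideanSpace ℝ (Fin 2), x ∈ Metric.closedBall (0 : EuclideanSpace ℝ (Fin 2)) 1 →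
      reflectLastCLM 1 x ∈ Metric.closedBall (0 : EuclideanSpace ℝ (Fin 2)) 1 := by
    intro x hx
    rw [mem_closedBall_zero_iff] at hx ⊢
    rwa [hR]
  have hdiff : Differentiable ℝ f := hsmooth.differentiable (by simp)
  have hdiff2 : Differentiable ℝ (fun y ↦ ‖f y‖ ^ 2) := hdiff.norm_sq ℝ
  refine ⟨hsmooth.comp (reflectLastCLM 1).contDiff, ?_, ?_, ?_, ?_, ?_⟩
  · intro x hx y hy hxy
    exact reflectLastCLM_injective 1 (hinj (hRball x hx) (hRball y hy) hxy)
  · intro x hx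
    rw [fderiv_comp x (hdiff _) (reflectLastCLM 1).differentiableAt, ContinuousLinearMap.fderiv]
    exact (himm _ (hRball x hx)).comp (reflectLastCLM_injective 1)
  · intro x hx
    exact hin _ (by rw [hR]; exact hx)
  · intro x hx
    have hcomp : (fun y ↦ ‖(f ∘ reflectLastCLM 1) y‖ ^ 2) = (fun y ↦ ‖f y‖ ^ 2) ∘ reflectLastCLM 1 :=
      rfl
    rw [hcomp, fderiv_comp x (hdiff2 _) (reflectLastCLM 1).differentiableAt,
      ContinuousLinearMap.fderiv]
    exact hneat _ (by rw [hR]; exact hx)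
  · intro x
    change f (reflectLastCLM 1 (x : EuclideanSpace ℝ (Fin 2))) = _
    rw [← coe_reflectLast]
    exact hbd (reflectLast 1 x)

/-- The reverse of a smoothly slice knot is smoothly slice. [cite: Livingston2005, §2.1] -/
theorem isSmoothlySlice_reverse {K : Knot} (h : K.IsSmoothlySlice) : K.reverse.IsSmoothlySlice := by
  obtain ⟨f, hf⟩ := h
  exact ⟨_, isSliceDisc_reverse hf⟩

/-- `Kʳ` is smoothly slice iff `K` is. [cite: Livingston2005, §2.1] -/
theorem isSmoothlySlice_reverse_iff (K : Knot) : K.reverse.IsSmoothlySlice ↔ K.IsSmoothlySlice :=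
  ⟨fun h ↦ by simpa using isSmoothlySlice_reverse h, isSmoothlySlice_reverse⟩

/-- `-K̄ = K̄ʳ` (the concordance inverse) is smoothly slice iff `K` is. [cite: Livingston2005, §2.1] -/
theorem isSmoothlySlice_mirror_reverse_iff (K : Knot) : K.mirror.reverse.IsSmoothlySlice ↔ K.IsSmoothlySlice :=
  (isSmoothlySlice_reverse_iff K.mirror).trans (isSmoothlySlice_mirror_iff K)

/-! ## Surgery does not see the string orientation -/

/-- Reversing the unique component of the one-component framed link `(K, m)` gives `(Kʳ, m)` (same framing
integer). [cite: Kirby1989, Ch. I §2] -/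
theorem single_reverseComponent (K : Knot) (m : ℤ) :
    (FramedLink.single K m).reverseComponent 0 = FramedLink.single K.reverse m := by
  simp only [FramedLink.reverseComponent, FramedLink.single]
  congr 1
  congr 1
  funext i
  rw [Subsingleton.elim i 0, update_self]

/-- **`m`-surgery on `K` is `m`-surgery on `Kʳ`, for the same `Y`** (any charted space `Y`): the PROVED Kirby
fact "framed links are unoriented" (`FramedLink.IsSurgery.reverseComponent_holds`) transported through
`FramedLink.isSurgery_single_iff`. [cite: Kirby1989, Ch. I §2] -/
theorem isIntegralSurgery_reverse {Y : Type} [TopologicalSpace Y] [ChartedSpace (EuclideanSpace ℝ (Fin 3)) Y]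
    {K : Knot} {m : ℤ} (h : IsIntegralSurgery (𝓡 3) Y K m) : IsIntegralSurgery (𝓡 3) Y K.reverse m := by
  rw [← FramedLink.isSurgery_single_iff] at h ⊢
  rw [← single_reverseComponent]
  exact FramedLink.IsSurgery.reverseComponent_holds h 0

/-- `Y` is `m`-surgery on `Kʳ` iff it is `m`-surgery on `K`. [cite: Kirby1989, Ch. I §2] -/
theorem isIntegralSurgery_reverse_iff {Y : Type} [TopologicalSpace Y] [ChartedSpace (EuclideanSpace ℝ (Fin 3)) Y]
    (K : Knot) (m : ℤ) : IsIntegralSurgery (𝓡 3) Y K.reverse m ↔ IsIntegralSurgery (𝓡 3) Y K m :=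
  ⟨fun h ↦ by simpa using isIntegralSurgery_reverse h, isIntegralSurgery_reverse⟩

/-- **Every knot is a `0`-friend of its reverse**: whenever `Y` is `0`-surgery on `K`, the triple `(K, Kʳ, Y)`
satisfies the two pair hypotheses of the crux. In print this is the remark behind Livingston's counterexample to
the Akbulut–Kirby conjecture (Kirby Problem 1.19): a knot need not be concordant to its reverse, although their
`0`-surgeries coincide (Abe–Tagami 2016, §1) — the simplest NON-CONCORDANT `0`-friends, so the pair relation of
the crux does not bound the concordance class. [cite: AbeTagami2016, §1] -/
theorem zeroSurgeryPair_self_reverse {Y : Type} [TopologicalSpace Y] [ChartedSpace (EuclideanSpace ℝ (Fin 3)) Y]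
    {K : Knot} (h : IsIntegralSurgery (𝓡 3) Y K 0) :
    IsIntegralSurgery (𝓡 3) Y K 0 ∧ IsIntegralSurgery (𝓡 3) Y K.reverse 0 :=
  ⟨h, isIntegralSurgery_reverse h⟩

/-- The reverse pair hypotheses are always realised by some `Y` (existence of Dehn surgery, PROVED). [cite: GompfStipsicz1999, §5.3] -/
theorem reversePair_exists (K : Knot) :
    ∃ (Y : Type) (_ : TopologicalSpace Y) (_ : ChartedSpace (EuclideanSpace ℝ (Fin 3)) Y),
      IsIntegralSurgery (𝓡 3) Y K 0 ∧ IsIntegralSurgery (𝓡 3) Y K.reverse 0 := by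
  obtain ⟨Y, _, _, _, _, _, _, hY⟩ := exists_isIntegralSurgery_holds K 0
  exact ⟨Y, _, _, zeroSurgeryPair_self_reverse hY⟩

/-! ## The reverse and inverse partners are dead; witnesses are closed under reversal -/

/-- **The REVERSE partner is contradictory**: `(K, Kʳ, Y)` is always a `0`-pair, but `Kʳ` is slice when `K` is.
[cite: Livingston2005, §2.1] -/
theorem zseThesis_reverseWitness_false :
    ¬ ∃ (K : Knot) (Y : Type) (_ : TopologicalSpace Y) (_ : ChartedSpace (EuclideanSpace ℝ (Fin 3)) Y),
        IsIntegralSurgery (𝓡 3) Y K 0 ∧ IsIntegralSurgery (𝓡 3) Y K.reverse 0 ∧ K.IsSmoothlySlice ∧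
          ¬ K.reverse.IsSmoothlySlice := by
  rintro ⟨K, Y, _, _, -, -, h3, h4⟩
  exact h4 ((isSmoothlySlice_reverse_iff K).2 h3)

/-- **The INVERSE partner `-K̄ = K̄ʳ` is contradictory** as well (`(K, K̄ʳ, Y)` is a `0`-pair by mirror and
reverse closure; `K̄ʳ` is slice when `K` is). [cite: Livingston2005, §2.1] -/
theorem zseThesis_mirrorReverseWitness_false :
    ¬ ∃ (K : Knot) (Y : Type) (_ : TopologicalSpace Y) (_ : ChartedSpace (EuclideanSpace ℝ (Fin 3)) Y),
        IsIntegralSurgery (𝓡 3) Y K 0 ∧ IsIntegralSurgery (𝓡 3) Y K.mirror.reverse 0 ∧ K.IsSmoothlySlice ∧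
          ¬ K.mirror.reverse.IsSmoothlySlice := by
  rintro ⟨K, Y, _, _, -, -, h3, h4⟩
  exact h4 ((isSmoothlySlice_mirror_reverse_iff K).2 h3)

/-- The inverse-partner pair hypotheses are always available (so the previous lemma is not vacuous).
[cite: GompfStipsicz1999, §5.3] -/
theorem mirrorReversePair_exists (K : Knot) :
    ∃ (Y : Type) (_ : TopologicalSpace Y) (_ : ChartedSpace (EuclideanSpace ℝ (Fin 3)) Y),
      IsIntegralSurgery (𝓡 3) Y K 0 ∧ IsIntegralSurgery (𝓡 3) Y K.mirror.reverse 0 := by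
  obtain ⟨Y, _, _, _, _, _, _, hY⟩ := exists_isIntegralSurgery_holds K 0
  exact ⟨Y, _, _, hY, isIntegralSurgery_reverse ((isIntegralSurgery_zero_mirror_iff K).2 hY)⟩

/-- **Reverse closure of witnesses**: `(Kʳ, K'ʳ, Y)` is a witness whenever `(K, K', Y)` is, with the same `Y`.
[cite: Kirby1989, Ch. I §2] -/
theorem zseThesis_witness_reverse {K K' : Knot} {Y : Type} [TopologicalSpace Y]
    [ChartedSpace (EuclideanSpace ℝ (Fin 3)) Y]
    (h1 : IsIntegralSurgery (𝓡 3) Y K 0) (h2 : IsIntegralSurgery (𝓡 3) Y K' 0) (h3 : K.IsSmoothlySlice)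
    (h4 : ¬ K'.IsSmoothlySlice) :
    IsIntegralSurgery (𝓡 3) Y K.reverse 0 ∧ IsIntegralSurgery (𝓡 3) Y K'.reverse 0 ∧
      K.reverse.IsSmoothlySlice ∧ ¬ K'.reverse.IsSmoothlySlice :=
  ⟨isIntegralSurgery_reverse h1, isIntegralSurgery_reverse h2, (isSmoothlySlice_reverse_iff K).2 h3,
    fun h ↦ h4 ((isSmoothlySlice_reverse_iff K').1 h)⟩

/-- **Profile addendum**: in any witness the partner `K'` is isotopic to none of `K`, `Kʳ`, `K̄ʳ` (nor `K̄`,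
`witness_profile`) — the four symmetric images of a slice knot are slice `0`-friends of it.
[cite: Livingston2005, §2.1] -/
theorem witness_not_isotopic_symmetries {K K' : Knot} {Y : Type} [TopologicalSpace Y]
    [ChartedSpace (EuclideanSpace ℝ (Fin 3)) Y]
    (_h1 : IsIntegralSurgery (𝓡 3) Y K 0) (_h2 : IsIntegralSurgery (𝓡 3) Y K' 0) (h3 : K.IsSmoothlySlice)
    (h4 : ¬ K'.IsSmoothlySlice) :
    ¬ K.reverse.IsIsotopic K' ∧ ¬ K.mirror.reverse.IsIsotopic K' := by
  refine ⟨fun h5 ↦ h4 ?_, fun h5 ↦ h4 ?_⟩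
  · exact Knot.IsSmoothlySlice.of_isIsotopic_holds h5 ((isSmoothlySlice_reverse_iff K).2 h3)
  · exact Knot.IsSmoothlySlice.of_isIsotopic_holds h5 ((isSmoothlySlice_mirror_reverse_iff K).2 h3)

end Summit.SmoothPoincare4.SmoothPoincare4.Theorems.ZseThesis.Negative

end
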